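import Mathlib.Topology.Algebra.OpenSubgroup
import Mathlib.GroupTheory.FreeGroup.Basic
import Mathlib.GroupTheory.Index
import Mathlib.Data.Nat.Factors
import Mathlib.Tactic.Group
import Literature.AnabelianGeometry.SemiGraphs.Coverticial
import HarnessLib

/-!
# Uniform convergence `θ_n → id` of unipotent twists of a topologically generated group
# (FRONTIER programme «REFUTE-F1732», brick R1b — binder form over the R1 interface)

Context (cell abc-iut, layer L3; L3-lead α59/α62, page of record
`plan/L3/SUBDAG-SemiAnbd-Thm37iii-REFUTE.md`): towards a kernel erratum for the ∀-countable reading of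
[SemiAnbd] Thm 3.7 (iii) (Mochizuki, *Semi-graphs of anabelioids*, Publ. RIMS **42** (2006), §3 p. 40;
[IUTchI] Rmk 2.5.3); desk countermodel abc-iut-L3-d1 g3 memo 8b26b5199c29f55f (the ray of free pro-`p`
groups of rank two glued along `1 ↦ a` / `1 ↦ a·b^{p^{n_k}}`); print proves the theorem for FINITE
`𝔾` (kernel: `compactInVerticialAt_of_finiteGraph`, p431007).  Nothing here asserts or refutes abc; no side
is taken on [IUTchIII] Cor. 3.12. [cite: MochizukiSemiAnbd2006, Thm 3.7(iii) p.40]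

This file is the brick **R1b** of the holder table (α62): the two facts about the gluing automorphisms
`θ_n : a ↦ a·b^{p^n}, b ↦ b` of the vertex group `G` that the later bricks (R3 object, R4/R5 hypotheses,
R6 escape) consume, in BINDER form over the R1 interface (so that nothing waits on R1's landing) and in
pure Mathlib topological-group currency:

* **`θ_n → id` UNIFORMLY** — the acceptance form (iii) of the R-programme reviewer abc-iut-L3-d1
  (08:41:20Z): "∀ `U` open normal, ∃ `n₀`, ∀ `n ≥ n₀`, ∀ `x`, `θ_n x · x⁻¹ ∈ U`".  Mechanism
  (`forall_mul_inv_mem_of_dense_closure`): for a continuous endomorphism `θ` of a topological group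
  and an open normal subgroup `U`, the agreement locus `{x | θ x · x⁻¹ ∈ U}` is a CLOSED SUBGROUP, so it is
  everything as soon as it contains a topologically generating set; for the twists it contains `b`
  always and `a` iff `b^{p^n} ∈ U`, which holds for `n ≥ e` once `b^{p^e} ∈ U`
  (`twist_mul_inv_mem_of_pow_mem`, `exists_forall_twist_mul_inv_mem`); in a pro-`{p}` group every open
  normal `U` has `p`-power index, so `b^{p^e} ∈ U` with `p^e = [G : U]`
  (`exists_pow_prime_pow_mem_of_isSigmaInteger`), whence the R1-facing corollary over the tree's
  `IsProSigmaCompletion {p} (ι : FreeGroup (Fin 2) →* G)` (`IsProSigmaCompletion.exists_forall_twist_mul_inv_mem`).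
* **`θ_n(U) = U`** for the characteristic open subgroups the programme exposes: for the index-bounded
  core `G(d)` this IS the tree's `map_charOpenCore_eq` (CharacteristicOpenCore.lean, abc-iut-L3 (T4)
  chain) — not restated; recorded here only in the generic Mathlib form for an arbitrary characteristic
  subgroup (`comap_comp_eq_of_characteristic`: the twisted gluing `θ ∘ α` pulls `U` back to `α⁻¹ U`, the
  well-definedness R3/R4 use).

Proof-only (no definition, no new named fact).  Seat abc-iut-w5-d215 (gen 5).
-/

namespace Literature.AnabelianGeometry.SemiGraphs

namespace TwistConvergence

open Topology SemiGraphOfAnabelioids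

universe u

variable {G : Type u} [Group G] [TopologicalSpace G] [IsTopologicalGroup G]

/-! ### The agreement locus of a continuous endomorphism modulo an open normal subgroup -/

/-- **Closure of agreement.**  Let `θ` be a continuous endomorphism of a topological group `G`, `U` an
open normal subgroup, and `S ⊆ G` a set generating a DENSE subgroup (topological generators).  If
`θ s · s⁻¹ ∈ U` for every `s ∈ S`, then `θ x · x⁻¹ ∈ U` for EVERY `x ∈ G`: the agreement locus
`{x | θ x ≡ x mod U}` is a subgroup (normality of `U`), closed (`U` is open, hence closed, and
`x ↦ (θ x)⁻¹ · x` is continuous), and contains `S`. [cite: MochizukiSemiAnbd2006, Thm 3.7(iii) p.40] -/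
theorem forall_mul_inv_mem_of_dense_closure (θ : G →* G) (hθ : Continuous θ) (U : Subgroup G)
    [U.Normal] (hU : IsOpen (U : Set G)) {S : Set G}
    (hS : Dense ((Subgroup.closure S : Subgroup G) : Set G)) (hgen : ∀ s ∈ S, θ s * s⁻¹ ∈ U) :
    ∀ x : G, θ x * x⁻¹ ∈ U := by
  -- the agreement locus as the equaliser of `mk ∘ θ` and `mk : G → G ⧸ U`
  let K : Subgroup G := ((QuotientGroup.mk' U).comp θ).eqLocus (QuotientGroup.mk' U)
  have hKmem : ∀ x : G, x ∈ K ↔ θ x * x⁻¹ ∈ U := by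
    intro x
    change (QuotientGroup.mk' U) (θ x) = (QuotientGroup.mk' U) x ↔ _
    rw [QuotientGroup.mk'_apply, QuotientGroup.mk'_apply, QuotientGroup.eq]
    -- `(θ x)⁻¹ * x ∈ U ↔ θ x * x⁻¹ ∈ U` by normality
    constructor
    · intro h
      have h1 := Subgroup.Normal.conj_mem inferInstance _ (U.inv_mem h) x
      have heq : x * ((θ x)⁻¹ * x)⁻¹ * x⁻¹ = θ x * x⁻¹ := by group
      rwa [heq] at h1
    · intro h
      have h1 := Subgroup.Normal.conj_mem inferInstance _ (U.inv_mem h) x⁻¹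
      have heq : x⁻¹ * (θ x * x⁻¹)⁻¹ * x⁻¹⁻¹ = (θ x)⁻¹ * x := by group
      rwa [heq] at h1
  -- `K` is closed: preimage of the closed set `U` under the continuous `x ↦ (θ x)⁻¹ * x`
  have hKclosed : IsClosed (K : Set G) := by
    have hcont : Continuous fun x : G => (θ x)⁻¹ * x := (hθ.inv).mul continuous_id
    have hset : (K : Set G) = (fun x : G => (θ x)⁻¹ * x) ⁻¹' (U : Set G) := by
      ext x
      change x ∈ K ↔ (θ x)⁻¹ * x ∈ U
      change (QuotientGroup.mk' U) (θ x) = (QuotientGroup.mk' U) x ↔ _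
      rw [QuotientGroup.mk'_apply, QuotientGroup.mk'_apply, QuotientGroup.eq]
    rw [hset]
    exact (Subgroup.isClosed_of_isOpen U hU).preimage hcont
  -- `S ⊆ K`, hence `closure S ≤ K`, hence (density + closedness) `K = ⊤`
  have hSK : Subgroup.closure S ≤ K := (Subgroup.closure_le K).2 fun s hs => (hKmem s).2 (hgen s hs)
  have htop : (Subgroup.closure S).topologicalClosure ≤ K :=
    Subgroup.topologicalClosure_minimal _ hSK hKclosed
  intro x
  have hx : x ∈ (Subgroup.closure S).topologicalClosure := by
    change x ∈ _root_.closure ((Subgroup.closure S : Subgroup G) : Set G)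
    rw [hS.closure_eq]
    trivial
  exact (hKmem x).1 (htop hx)

/-- The same conclusion in the quotient: `θ x ≡ x (mod U)` for all `x`.
[cite: MochizukiSemiAnbd2006, Thm 3.7(iii) p.40] -/
theorem forall_mk_eq_of_dense_closure (θ : G →* G) (hθ : Continuous θ) (U : Subgroup G)
    [U.Normal] (hU : IsOpen (U : Set G)) {S : Set G}
    (hS : Dense ((Subgroup.closure S : Subgroup G) : Set G)) (hgen : ∀ s ∈ S, θ s * s⁻¹ ∈ U) (x : G) :
    (QuotientGroup.mk (θ x) : G ⧸ U) = QuotientGroup.mk x := by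
  have h := forall_mul_inv_mem_of_dense_closure θ hθ U hU hS hgen x
  rw [QuotientGroup.eq]
  have h1 := Subgroup.Normal.conj_mem inferInstance _ (U.inv_mem h) x⁻¹
  have heq : x⁻¹ * (θ x * x⁻¹)⁻¹ * x⁻¹⁻¹ = (θ x)⁻¹ * x := by group
  rwa [heq] at h1

/-! ### The unipotent twists `θ : a ↦ a·b^{p^n}, b ↦ b` -/

/-- **One twist, one level.**  `G` topologically generated by `a, b`; `θ` a continuous endomorphism with
`θ a = a · b^{p^n}`, `θ b = b`; `U` open normal with `b^{p^n} ∈ U`.  Then `θ ≡ id (mod U)`: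
`θ x · x⁻¹ ∈ U` for all `x`. [cite: MochizukiSemiAnbd2006, Thm 3.7(iii) p.40] -/
theorem twist_mul_inv_mem {a b : G} (hab : Dense ((Subgroup.closure {a, b} : Subgroup G) : Set G))
    {p n : ℕ} (θ : G →* G) (hθ : Continuous θ) (hθa : θ a = a * b ^ (p ^ n)) (hθb : θ b = b)
    (U : Subgroup G) [U.Normal] (hU : IsOpen (U : Set G)) (hbU : b ^ (p ^ n) ∈ U) :
    ∀ x : G, θ x * x⁻¹ ∈ U := by
  refine forall_mul_inv_mem_of_dense_closure θ hθ U hU hab fun s hs => ?_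
  rcases hs with rfl | hs
  · -- `θ a · a⁻¹ = a · b^{p^n} · a⁻¹ ∈ U` (normality)
    rw [hθa]
    exact Subgroup.Normal.conj_mem inferInstance _ hbU _
  · rw [Set.mem_singleton_iff] at hs
    subst hs
    rw [hθb, mul_inv_cancel]
    exact U.one_mem

omit [TopologicalSpace G] [IsTopologicalGroup G] in
/-- Powers `b^{p^n}`, `n ≥ e`, lie in `U` as soon as `b^{p^e}` does (bookkeeping for the twists of the
countermodel to the ∀-countable reading of Thm 3.7 (iii)). [cite: MochizukiSemiAnbd2006, Thm 3.7(iii) p.40] -/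
theorem pow_prime_pow_mem_of_le {b : G} {p e n : ℕ} (U : Subgroup G) (hbU : b ^ (p ^ e) ∈ U)
    (hn : e ≤ n) : b ^ (p ^ n) ∈ U := by
  obtain ⟨k, rfl⟩ := Nat.exists_eq_add_of_le hn
  rw [pow_add, pow_mul]
  exact U.pow_mem hbU _

/-- **`θ_n → id` UNIFORMLY** (R-programme reviewer's acceptance form (iii), abc-iut-L3-d1 08:41:20Z: "∀ `U`
open normal, ∃ `n₀`, ∀ `n ≥ n₀`, ∀ `x`, `θ_n x · x⁻¹ ∈ U`"), in binder form: `G` topologically generated by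
`a, b`; continuous endomorphisms `θ n` with `θ n a = a · b^{p^n}`, `θ n b = b`; `U` open normal containing
SOME `b^{p^e}` (automatic in a pro-`p` group, below).  Then `θ n ≡ id (mod U)` for all `n ≥ e`.
[cite: MochizukiSemiAnbd2006, Thm 3.7(iii) p.40] -/
theorem exists_forall_twist_mul_inv_mem {a b : G}
    (hab : Dense ((Subgroup.closure {a, b} : Subgroup G) : Set G)) {p : ℕ} (θ : ℕ → G →* G)
    (hθ : ∀ n, Continuous (θ n)) (hθa : ∀ n, θ n a = a * b ^ (p ^ n)) (hθb : ∀ n, θ n b = b)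
    (U : Subgroup G) [U.Normal] (hU : IsOpen (U : Set G)) (hbU : ∃ e, b ^ (p ^ e) ∈ U) :
    ∃ n₀ : ℕ, ∀ n, n₀ ≤ n → ∀ x : G, θ n x * x⁻¹ ∈ U := by
  obtain ⟨e, he⟩ := hbU
  exact ⟨e, fun n hn => twist_mul_inv_mem hab (θ n) (hθ n) (hθa n) (hθb n) U hU
    (pow_prime_pow_mem_of_le U he hn)⟩

/-- The same, `Filter.Eventually` phrasing: eventually in `n`, `θ n ≡ id (mod U)` on all of `G`.
[cite: MochizukiSemiAnbd2006, Thm 3.7(iii) p.40] -/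
theorem eventually_forall_twist_mul_inv_mem {a b : G}
    (hab : Dense ((Subgroup.closure {a, b} : Subgroup G) : Set G)) {p : ℕ} (θ : ℕ → G →* G)
    (hθ : ∀ n, Continuous (θ n)) (hθa : ∀ n, θ n a = a * b ^ (p ^ n)) (hθb : ∀ n, θ n b = b)
    (U : Subgroup G) [U.Normal] (hU : IsOpen (U : Set G)) (hbU : ∃ e, b ^ (p ^ e) ∈ U) :
    ∀ᶠ n in Filter.atTop, ∀ x : G, θ n x * x⁻¹ ∈ U := by
  obtain ⟨n₀, h⟩ := exists_forall_twist_mul_inv_mem hab θ hθ hθa hθb U hU hbU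
  exact Filter.eventually_atTop.2 ⟨n₀, h⟩

/-- **`θ_n → id` UNIFORMLY, in the R1 binder tuple** «`(G) (a b) … (θ : ℕ → G ≃ₜ* G) (hθa) (hθb)`»
(abc-iut-w6-d019, α66): the twists given as isomorphisms of topological groups.
[cite: MochizukiSemiAnbd2006, Thm 3.7(iii) p.40] -/
theorem exists_forall_twist_mul_inv_mem_equiv {a b : G}
    (hab : Dense ((Subgroup.closure {a, b} : Subgroup G) : Set G)) {p : ℕ} (θ : ℕ → G ≃ₜ* G)
    (hθa : ∀ n, θ n a = a * b ^ (p ^ n)) (hθb : ∀ n, θ n b = b)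
    (U : Subgroup G) [U.Normal] (hU : IsOpen (U : Set G)) (hbU : ∃ e, b ^ (p ^ e) ∈ U) :
    ∃ n₀ : ℕ, ∀ n, n₀ ≤ n → ∀ x : G, θ n x * x⁻¹ ∈ U :=
  exists_forall_twist_mul_inv_mem hab (fun n => (θ n).toMulEquiv.toMonoidHom)
    (fun n => (θ n).continuous) (fun n => hθa n) (fun n => hθb n) U hU hbU

/-! ### Pro-`p` groups: every open normal subgroup swallows some `b^{p^e}` -/

omit [TopologicalSpace G] [IsTopologicalGroup G] in
/-- In a group whose normal subgroup `U` has `p`-power index (`[G : U]` a `{p}`-integer in the tree's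
sense `Anabelioids.IsSigmaInteger {p}`), every element has some `p^e`-th power in `U` (namely
`p^e = [G : U]`) — pro-`p` groups, Ribes–Zalesskii §2.1. [cite: RibesZalesskii2010, §2.1] -/
theorem exists_pow_prime_pow_mem_of_isSigmaInteger {p : ℕ} (U : Subgroup G) [U.Normal]
    (hU : Anabelioids.IsSigmaInteger ({p} : Set ℕ) U.index) (g : G) : ∃ e : ℕ, g ^ (p ^ e) ∈ U := by
  have hne : U.index ≠ 0 := Nat.pos_iff_ne_zero.1 hU.1
  have hpow : U.index = p ^ U.index.primeFactorsList.length :=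
    Nat.eq_prime_pow_of_unique_prime_dvd hne fun hd hdvd => by
      simpa [Set.mem_singleton_iff] using hU.2 _ hd hdvd
  exact ⟨U.index.primeFactorsList.length, hpow ▸ U.pow_index_mem g⟩

omit [IsTopologicalGroup G] in
/-- For a pro-`{p}` completion `ι : Γ → G` (tree's `IsProSigmaCompletion {p} ι`) and an OPEN normal
subgroup `U`, every element of `G` has some `p^e`-th power in `U` (pro-`p` groups, Ribes–Zalesskii §2.1;
in the tree's pro-`Σ` completion currency of [SemiAnbd] Ex. 2.10). [cite: RibesZalesskii2010, §2.1] -/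
theorem _root_.Literature.AnabelianGeometry.SemiGraphs.SemiGraphOfAnabelioids.IsProSigmaCompletion.exists_pow_prime_pow_mem
    {Γ : Type*} [Group Γ] {p : ℕ} {ι : Γ →* G} (hι : IsProSigmaCompletion ({p} : Set ℕ) ι)
    (U : Subgroup G) [hN : U.Normal] (hU : IsOpen (U : Set G)) (g : G) : ∃ e : ℕ, g ^ (p ^ e) ∈ U :=
  exists_pow_prime_pow_mem_of_isSigmaInteger U (hι.index_open U hN hU) g

omit [IsTopologicalGroup G] in
/-- The images of the free generators topologically generate a pro-`Σ` completion of `FreeGroup ι₀`: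
the subgroup generated by `ι '' (range of)` is `ι(FreeGroup ι₀)`, which is dense (pro-`Σ` completions,
[SemiAnbd] Ex. 2.10 / tree `IsProSigmaCompletion`). [cite: MochizukiSemiAnbd2006, Ex. 2.10 p.31] -/
theorem _root_.Literature.AnabelianGeometry.SemiGraphs.SemiGraphOfAnabelioids.IsProSigmaCompletion.dense_closure_range_of
    {ι₀ : Type*} {Sigma : Set ℕ} {ι : FreeGroup ι₀ →* G} (hι : IsProSigmaCompletion Sigma ι) :
    Dense ((Subgroup.closure (Set.range fun i : ι₀ => ι (FreeGroup.of i)) : Subgroup G) : Set G) := by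
  have hcl : Subgroup.closure (Set.range fun i : ι₀ => ι (FreeGroup.of i)) = ι.range := by
    rw [show (Set.range fun i : ι₀ => ι (FreeGroup.of i)) = ι '' Set.range (FreeGroup.of : ι₀ → _) by
        ext x; simp, ← MonoidHom.map_closure, FreeGroup.closure_range_of, ← MonoidHom.range_eq_map]
  rw [hcl]
  exact hι.dense

omit [IsTopologicalGroup G] in
/-- For a pro-`Σ` completion `ι : FreeGroup (Fin 2) → G`, the two elements `a := ι x₀`, `b := ι x₁`
topologically generate `G` ([SemiAnbd] Ex. 2.10 currency). [cite: MochizukiSemiAnbd2006, Ex. 2.10 p.31] -/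
theorem _root_.Literature.AnabelianGeometry.SemiGraphs.SemiGraphOfAnabelioids.IsProSigmaCompletion.dense_closure_pair
    {Sigma : Set ℕ} {ι : FreeGroup (Fin 2) →* G} (hι : IsProSigmaCompletion Sigma ι) :
    Dense ((Subgroup.closure {ι (FreeGroup.of 0), ι (FreeGroup.of 1)} : Subgroup G) : Set G) := by
  have h := hι.dense_closure_range_of
  have hrange : (Set.range fun i : Fin 2 => ι (FreeGroup.of i)) =
      {ι (FreeGroup.of 0), ι (FreeGroup.of 1)} := by
    ext x
    simp only [Set.mem_range, Set.mem_insert_iff, Set.mem_singleton_iff]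
    constructor
    · rintro ⟨i, rfl⟩
      fin_cases i
      · exact Or.inl rfl
      · exact Or.inr rfl
    · rintro (rfl | rfl)
      · exact ⟨0, rfl⟩
      · exact ⟨1, rfl⟩
  rwa [hrange] at h

/-- **Topological 2-generation** in the shape brick R4 (H4) consumes (abc-iut-w4-d075, 08:57:55Z:
"`∃ s : Finset G, s.card ≤ 2 ∧ (Subgroup.closure ↑s).topologicalClosure = ⊤`", the
`IsStrictlyCoherent.exists_bound` shape): a pro-`Σ` completion of `FreeGroup (Fin 2)` is topologically
generated by a `Finset` of cardinality `≤ 2` — the (T4)/strict-coherence input of [IUTchI] Rmk 2.5.3 (i)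
for the countermodel's vertex groups. [cite: MochizukiSemiAnbd2006, Def 2.4 p.25] -/
theorem _root_.Literature.AnabelianGeometry.SemiGraphs.SemiGraphOfAnabelioids.IsProSigmaCompletion.exists_finset_card_le_two_topologicalClosure_eq_top
    {Sigma : Set ℕ} {ι : FreeGroup (Fin 2) →* G} (hι : IsProSigmaCompletion Sigma ι) :
    ∃ s : Finset G, s.card ≤ 2 ∧ (Subgroup.closure (s : Set G)).topologicalClosure = ⊤ := by
  classical
  refine ⟨{ι (FreeGroup.of 0), ι (FreeGroup.of 1)}, Finset.card_le_two, ?_⟩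
  rw [SetLike.ext'_iff, Subgroup.topologicalClosure_coe, Subgroup.coe_top, Finset.coe_pair]
  exact hι.dense_closure_pair.closure_eq

/-- **R1b at the R1 interface** (free pro-`p` of rank two as a pro-`{p}` completion
`ι : FreeGroup (Fin 2) → G`, generators `a := ι x₀`, `b := ι x₁`): for ANY family of continuous
endomorphisms `θ n` of `G` with `θ n a = a · b^{p^n}` and `θ n b = b` (the gluing twists of the
countermodel `𝒢_θ`), and ANY open normal `U ≤ G`, there is `n₀` with `θ n x · x⁻¹ ∈ U` for all `n ≥ n₀`
and all `x` — `θ_n → id` uniformly. [cite: MochizukiSemiAnbd2006, Thm 3.7(iii) p.40] -/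
theorem _root_.Literature.AnabelianGeometry.SemiGraphs.SemiGraphOfAnabelioids.IsProSigmaCompletion.exists_forall_twist_mul_inv_mem
    {p : ℕ} {ι : FreeGroup (Fin 2) →* G} (hι : IsProSigmaCompletion ({p} : Set ℕ) ι)
    (θ : ℕ → G →* G) (hθ : ∀ n, Continuous (θ n))
    (hθa : ∀ n, θ n (ι (FreeGroup.of 0)) = ι (FreeGroup.of 0) * ι (FreeGroup.of 1) ^ (p ^ n))
    (hθb : ∀ n, θ n (ι (FreeGroup.of 1)) = ι (FreeGroup.of 1))
    (U : Subgroup G) [U.Normal] (hU : IsOpen (U : Set G)) :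
    ∃ n₀ : ℕ, ∀ n, n₀ ≤ n → ∀ x : G, θ n x * x⁻¹ ∈ U :=
  TwistConvergence.exists_forall_twist_mul_inv_mem hι.dense_closure_pair θ hθ hθa hθb U hU
    (hι.exists_pow_prime_pow_mem U hU _)

/-- **R1b at the R1 interface, R1 binder tuple** (`θ : ℕ → G ≃ₜ* G`, abc-iut-w6-d019 α66): for a
pro-`{p}` completion `ι : FreeGroup (Fin 2) → G` with `a := ι x₀`, `b := ι x₁` and twists
`θ n a = a · b^{p^n}`, `θ n b = b`, EVERY open normal `U` eventually swallows `θ n x · x⁻¹` uniformly in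
`x`. [cite: MochizukiSemiAnbd2006, Thm 3.7(iii) p.40] -/
theorem _root_.Literature.AnabelianGeometry.SemiGraphs.SemiGraphOfAnabelioids.IsProSigmaCompletion.exists_forall_twist_mul_inv_mem_equiv
    {p : ℕ} {ι : FreeGroup (Fin 2) →* G} (hι : IsProSigmaCompletion ({p} : Set ℕ) ι)
    (θ : ℕ → G ≃ₜ* G)
    (hθa : ∀ n, θ n (ι (FreeGroup.of 0)) = ι (FreeGroup.of 0) * ι (FreeGroup.of 1) ^ (p ^ n))
    (hθb : ∀ n, θ n (ι (FreeGroup.of 1)) = ι (FreeGroup.of 1))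
    (U : Subgroup G) [U.Normal] (hU : IsOpen (U : Set G)) :
    ∃ n₀ : ℕ, ∀ n, n₀ ≤ n → ∀ x : G, θ n x * x⁻¹ ∈ U :=
  TwistConvergence.exists_forall_twist_mul_inv_mem_equiv hι.dense_closure_pair θ hθa hθb U hU
    (hι.exists_pow_prime_pow_mem U hU _)

/-! ### `θ(U) = U` for characteristic `U` (generic Mathlib form; the tree's `charOpenCore` case is
`map_charOpenCore_eq`, CharacteristicOpenCore.lean, not restated) -/

omit [TopologicalSpace G] [IsTopologicalGroup G] in
/-- A characteristic subgroup is carried to itself by every automorphism (`Subgroup.characteristic_iff_map_eq`);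
recorded for the R-programme in the two shapes the gluing bookkeeping uses (twisted gluings of the
countermodel to the ∀-countable reading of Thm 3.7 (iii)). [cite: MochizukiSemiAnbd2006, Thm 3.7(iii) p.40] -/
theorem map_eq_of_characteristic (U : Subgroup G) (hU : U.Characteristic) (θ : G ≃* G) :
    U.map θ.toMonoidHom = U ∧ U.comap θ.toMonoidHom = U :=
  ⟨Subgroup.characteristic_iff_map_eq.1 hU θ, Subgroup.characteristic_iff_comap_eq.1 hU θ⟩

omit [TopologicalSpace G] [IsTopologicalGroup G] in
/-- **Well-definedness of the twisted gluing**: for `U` characteristic and `θ` an automorphism, the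
twisted branch map `θ ∘ α` pulls `U` back to the same subgroup as `α` does — `(θ ∘ α)⁻¹ U = α⁻¹ U`
(memo (H4)/(H5): "`(θ_kα)⁻¹(G(M)) = α⁻¹(θ_k⁻¹G(M)) = α⁻¹(G(M))` (characteristic)").
[cite: MochizukiSemiAnbd2006, Thm 3.7(iii) p.40] -/
theorem comap_comp_eq_of_characteristic {E : Type*} [Group E] (α : E →* G) (U : Subgroup G)
    (hU : U.Characteristic) (θ : G ≃* G) :
    U.comap (θ.toMonoidHom.comp α) = U.comap α := by
  rw [← Subgroup.comap_comap, Subgroup.characteristic_iff_comap_eq.1 hU θ]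

end TwistConvergence

end Literature.AnabelianGeometry.SemiGraphs
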